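import Summits.QuantumFields.YangMills.Theorems.BalabanLadderIRPinnedExitCofinal
import Summits.QuantumFields.YangMills.Theorems.BalabanLadderIRRankPurityCofinalDefs
import Summits.QuantumFields.YangMills.Theorems.BalabanLadderIRTwistCostOfPurity
import Summits.QuantumFields.YangMills.Theorems.BalabanLadderIRColdPurityDobrushinCorner
import Summits.QuantumFields.YangMills.Theses.BalabanLadder
import Summits.QuantumFields.YangMills.Theorems.IR.RunningLandmarkDefs
import HarnessLib

/-!
# Crux `IRcof` (stmt-QuantumFields-26930) — LINE `landmark-ladder` (ideator ym-ir-idea-24 g0, LINE 2; lens «recomb2», technique: recombination of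
# LINE 1 `running-landmark` (its junction J) with row 42 `deconfinement-ruler` ((G), (CF)) through ONE NEW floor-free, unit-free statement
# (LS) `LandmarkSpacing` and the PROVED seam `(J) ∧ (LS) ⇒ (CU)`; assembles BY TOKEN (D-0146) onto the slot `pinned_cofinal_bill.lean` rev 2
# {PXcof(1∕24), N_cof})

HONEST FRAMING.  Nothing in this file proves the Yang–Mills mass gap (Clay), `IRcof`, `IR`, PXcof, confinement or any purity certificate; R2c stays
IDEA-BOUND; nothing continuum ∕ OS ∕ Clay.  The sorries are confined to the five `stub_*` declarations of §2; everything else is kernel-checked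
bookkeeping over landed theorems.  The slot of record is the LEAD's (`pinned_cofinal_bill.lean`); this file never registers against it.

REV 2 (2026-08-28, after VERDICT-landmark-ladder-idea24-crit3-g4 = PASS-WITH-PRICE, variant «48b»): §5 types the critic's P2 split «LS = LS_UV ∧ LS_IR» in the
floor's unit — (FF) `FemtoFreeze` (UV half, R4∕(RW)-class, NEW token) and row 42's (CU) `PinnedConfinedCofinal` (IR half, verbatim) — and PROVES
`(FF) ∧ (CU) ⇒ (LS)_a` (`landmarkSpacingFloor_of_split`), `(J) ∧ (LS)_a ⇒ (CU)` (`pinnedConfinedCofinal_of_floor`), hence `(LS)_a ⟺ (CU)` modulo (J), (FF)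
(`landmarkSpacingFloor_iff_cu`), where `(LS)_a = LandmarkSpacingFloor` is (LS) asked only under the floor (`landmarkSpacingFloor_of`).  READING NOTE (bus
21:02:39Z): the tree's twisted partition function is 't Hooft's TEMPORAL twist (`tHooftTwistFactor` reads `z 0, z 1, z 2`; time = the short axis), so every
twist ratio in this file is an ELECTRIC ratio `r_k` of the thermal box `ℓ³ × ⌊ℓ∕4⌋` at `T = 4∕(aℓ)` (eng-2's E2-Q3 observable); along `ℓ` at fixed `β` it is
femto-frozen (`≈ C·ḡ(ℓ)^p`), possibly bumps, is interface-frozen through the deconfined window and tends to `1` past `⌊ℓ∕4⌋ > N_{τ,c}(β)`; `ℓ_η` is the femto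
landmark for `η` below the bump and `≈ L_conf` above it — (LS) holds in both readings.  Stubs unchanged (5); nothing new is claimed toward the wall.

THE LADDER (three landmarks of one coupling `β`, all read off 't Hooft's twisted partition functions of the cold `4:1` box `ℓ³ × ⌊ℓ∕4⌋`):
* the floor's scale `1∕a(β)` (extrinsic; `LowerBounds G r a`);
* the PERTURBATIVE landmark `ℓ_η(β)` = least half-side at which SOME nontrivial central twist is `η`-thawed, `r_z(β,ℓ) = Z^{(z)}∕Z ≥ η` (`ThawedAt`, LINE 1);
* the CONFINEMENT landmark `L_conf(β)` = a half-side at which EVERY central twist costs at most `η_c·Z` (`MarginConfinedAt`, row 42 verbatim);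
* the PURITY scale (a `θ`-pure cold box, `coldDefect ≤ θ`).
The slot's token PXcof(θ) asks for a pure box within `T` floor units, cofinally in `β`.  The ladder climbs it in three rungs, each a separately named
statement with its own physical constant:
  (J)  `PinnedThaw`            floor ⇒ `ℓ_η ≤ R∕a(β)`            [LINE 1's junction; reduced THERE to the perturbative-window statements (RW) ∧ (H)]
  (LS) `LandmarkSpacing η_c`   `ℓ_η`-thaw ⇒ `η_c`-confined at `≤ T'(η)·ℓ`, cofinally in `β`   [NEW: prompt confinement in LANDMARK units — `√σ ∕ Λ_twisted`
                               bounded; floor-free, unit-free, Schwartz-free; instrumentable by twist ratios alone]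
  (G)  `ConfinedToPure η_c θ`  `η_c`-confined at `L'` ⇒ `θ`-pure at `κL'`   [row 42's located residual verbatim: the gap in `T_c` units]
  (CF) centre-free residual, N_cof by name.
PROVED here: `pinnedConfinedCofinal_of` ((J) ∧ (LS) ⇒ row 42's (CU) `PinnedConfinedCofinal η_c` — so the floor handshake (CU), PROVED NECESSARY for
PXcof by `deconfinement_ruler.pinnedConfinedCofinal_of_pxcof`, is DISCHARGED modulo LINE 1's (RW), (H) and the intrinsic (LS)); `pxcof_of_ruler` (row 42's
composition, re-proved verbatim so that no sorried file is imported); `pxcof_of`; the bill `IRcof_of` ∕ `IRcof_of_stubs` (the route decl literally);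
`landmarkSpacing_rung_dobrushin` (the (LS)-body at every coupling inside the Dobrushin door, one group-free `T'`, from the landed cold-purity corner and S1).

PARENTS (theorems, by name): `TwistCost.half_twist_cost_le_coldDefect` (S1), `TwistCost.twistedPartition_le` (domination),
`wilsonFinTorusTwistedPartition_pos ∕ _one`, `ColdPurityDobrushin.coldExitAt_corner_of_dobrushinTV`, `PinnedExitCofinal.cofinalGapOn_of_pinnedExits` (kernel
p616292); row 42's PROVED necessity `pinnedConfinedCofinal_of_pxcof` (cited, not imported).  OPEN parents BY TOKEN (verbatim restatement, no import of a
sorried file): LINE 1's `PinnedThaw`, row 42's `ConfinedToPure` ∕ `PinnedExitsCofinalCentreFreeAt`, N_cof `RankPurity.IRnscCof`.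
-/

open Filter Topology MeasureTheory
open Literature.MathematicalPhysics.QuantumFieldTheory Literature.MathematicalPhysics.QuantumLattice
open Summit.QuantumFields.YangMills.Cruxes.OSLegsFromFemtoAndGap.DlrCollarTransfer (LowerBounds)
open Summit.QuantumFields.YangMills.Cruxes.IR.ColdPurityBridge (coldDefect)
open Summit.QuantumFields.YangMills.Cruxes.IR.RankPurity (IRnscCof)
open Summit.QuantumFields.YangMills.Cruxes.IR.PinnedExitCofinal (cofinalGapOn_of_pinnedExits)
open Summit.QuantumFields.YangMills.Cruxes.IR.TwistCost (twistedPartition_le half_twist_cost_le_coldDefect)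
open Summit.QuantumFields.YangMills.Cruxes.IR.ColdPurityDobrushin (coldExitAt_corner_of_dobrushinTV)

namespace Summit.QuantumFields.YangMills.Cruxes.IRcof.LandmarkLadder

open Summit.QuantumFields.YangMills.Cruxes.IRcof.RunningLandmark
  (IsCentralTwist twistRatio ThawedAt thawedAt_mono thawedAt_of_pure centre_trivial_of_no_twist twistRatio_pos twistRatio_le_one
   PinnedExitsCofinalAt PinnedThaw PinnedExitsCofinalCentreFreeAt)

/-! ## §0 Vocabulary — rev 3: LINE 1's vocabulary and tokens (`IsCentralTwist`, `twistRatio`, `ThawedAt`, `thawedAt_mono`, `thawedAt_of_pure`,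
`centre_trivial_of_no_twist`, `PinnedExitsCofinalAt`, `PinnedThaw`, `PinnedExitsCofinalCentreFreeAt`) are IMPORTED BY NAME from the landed Theorems module
`Summits.QuantumFields.YangMills.Theorems.IR.RunningLandmarkDefs` (pool-p3 g15, p666269; verbatim texts; in-file copies deleted); row 42's tokens
(`MarginConfinedAt`, `PinnedConfinedCofinal`, `ConfinedToPure`) remain verbatim copies of `deconfinement_ruler.lean` §1 (no landed home). -/

section Vocabulary

variable {G : Type} [Group G] [TopologicalSpace G] [IsTopologicalGroup G] [CompactSpace G]
  [MeasurableSpace G] [BorelSpace G] {N : ℕ}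

/-- **`η`-MARGIN-CONFINED thick box** (row 42 verbatim): EVERY central temporal twist lowers `Z(L,L,L,⌊L∕4⌋)` by at most the fraction `η`. -/
def MarginConfinedAt (ρ : G →* Matrix (Fin N) (Fin N) ℂ) (β : ℝ) (L : ℕ) (η : ℝ) : Prop :=
  ∀ z : Fin 4 → G, (∀ μ, z μ ∈ Subgroup.center G) →
    1 - wilsonFinTorusTwistedPartition ρ β z L L L (L / 4) / wilsonFinTorusPartition ρ β L L L (L / 4) ≤ η

theorem marginConfinedAt_mono {ρ : G →* Matrix (Fin N) (Fin N) ℂ} {β η η' : ℝ} {L : ℕ} (hη : η ≤ η') (h : MarginConfinedAt ρ β L η) :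
    MarginConfinedAt ρ β L η' :=
  fun z hz => (h z hz).trans hη

/-- **PURITY FORCES MARGIN CONFINEMENT (S1, all twists)**: a `θ`-pure cold box of half-side `L ≥ 8` at `β ≥ 0` is `2θ`-margin-confined.
[parent: `TwistCost.half_twist_cost_le_coldDefect`] -/
theorem marginConfinedAt_of_pure [SecondCountableTopology G] {ρ : G →* Matrix (Fin N) (Fin N) ℂ} (hρ : Continuous ρ)
    (hρu : ∀ g, ρ g ∈ Matrix.unitaryGroup (Fin N) ℂ) {β θ : ℝ} (hβ : 0 ≤ β) {L : ℕ} (hL : 8 ≤ L)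
    (hpure : coldDefect ρ β L ≤ θ) : MarginConfinedAt ρ β L (2 * θ) := by
  intro z hz
  have h := (half_twist_cost_le_coldDefect hρ hρu hβ hL hz).1
  linarith

omit [TopologicalSpace G] [IsTopologicalGroup G] [CompactSpace G] [MeasurableSpace G] [BorelSpace G] in
/-- A nontrivial central temporal twist datum exhibits a nontrivial central element (row 42's hypothesis shape from LINE 1's). -/
theorem exists_center_ne_one_of_twist (h : ∃ z : Fin 4 → G, IsCentralTwist z) :
    ∃ c : G, c ∈ Subgroup.center G ∧ c ≠ 1 := by
  obtain ⟨z, hzc, i, hi⟩ := h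
  exact ⟨z i.castSucc, hzc _, hi⟩

/-- On a group with trivial centre every thick box is `η`-margin-confined for every `η ≥ 0` (the only central twist is `z = 1`, ratio `1`). -/
theorem marginConfinedAt_of_centre_trivial [SecondCountableTopology G] {ρ : G →* Matrix (Fin N) (Fin N) ℂ} (hρ : Continuous ρ)
    (htriv : ∀ c : G, c ∈ Subgroup.center G → c = 1) (β : ℝ) (L : ℕ) {η : ℝ} (hη : 0 ≤ η) : MarginConfinedAt ρ β L η := by
  intro z hz
  have hz1 : z = 1 := funext fun μ => htriv (z μ) (hz μ)
  subst hz1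
  have hpos := wilsonFinTorusTwistedPartition_pos ρ hρ β (1 : Fin 4 → G) L L L (L / 4)
  rw [wilsonFinTorusTwistedPartition_one] at hpos ⊢
  rw [div_self hpos.ne']
  linarith

end Vocabulary

/-! ## §1 The statements of the ladder -/

/-- **(LS) `LandmarkSpacing η_c` — PROMPT CONFINEMENT IN LANDMARK UNITS, COFINALLY (NEW; floor-free, unit-free, Schwartz-free, rate-free).**
For simply-connected compact simple `G` admitting a nontrivial central temporal twist and every `r`: for every `η ∈ (0,1)` there is `T'` such that
for every `β₁` SOME `β ≥ β₁` has the property «whenever a half-side `ℓ` is `η`-thawed, some thick box `L'` with `8 ≤ L' ≤ T'·ℓ` is `η_c`-margin-confined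
(EVERY central twist costs `≤ η_c·Z`)».  Reading: `L_conf(β) ≤ T'(η)·ℓ_η(β)` — the twisted finite-volume coupling runs from the perturbative value `r = η`
to the confinement value `r ≥ 1 − η_c` for all twists within a `β`-INDEPENDENT number of octaves (dimensional transmutation: `√σ ∕ Λ_twisted` is a finite
continuum number; ALPHA-type step scaling `L_max ∕ L₀`).  Why it might fail: a long crossover — a range of scales `[ℓ_η, L_conf]` whose length in octaves
grows along a cofinal set of couplings (an infrared-conformal window, or deconfinement at `T = 0`, for some simple `G`); for `SU(N)` none is expected, but
at weak coupling the upper bound on `L_conf` IS Wilson's confinement problem in physical units — INFRARED CONTENT, declared (same wall as census §K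
«PROMPTNESS-INSIDE-PXcof», re-based from the floor's unit `n_ε⁻` of row 44 (A) to the intrinsic landmark `ℓ_η`).  Vacuous at couplings where nothing
thaws (there (J) fails, and the floor with it).  Sources: 't Hooft NPB 153 (1979) §5; de Divitiis–Frezzotti–Guagnelli–Petronzio NPB 422 (1994) 382
(hep-lat/9312085), NPB 433 (1995) 390 (hep-lat/9407028) — twisted-Polyakov-loop running coupling and its step scaling; Lüscher–Sommer–Weisz–Wolff
NPB 413 (1994) 481 (`L_max`); de Forcrand–Jahn NPB 651 (2003) 125 (hep-lat/0211004) ('t Hooft loops ∕ electric-flux free energies vs. `σ`). -/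
def LandmarkSpacing (ηc : ℝ) : Prop :=
  ∀ (G : Type) [Group G] [TopologicalSpace G] [IsTopologicalGroup G] [CompactSpace G],
    IsCompactSimpleLieGroup G → SimplyConnectedSpace G → (∃ z : Fin 4 → G, IsCentralTwist z) →
    letI : MeasurableSpace G := borel G
    haveI : BorelSpace G := ⟨rfl⟩
    ∀ r : LatticeRep G, ∀ η : ℝ, 0 < η → η < 1 → ∃ T' : ℝ, ∀ β₁ : ℝ, ∃ β : ℝ, β₁ ≤ β ∧
      ∀ ℓ : ℕ, ThawedAt r.ρ β η ℓ → ∃ L' : ℕ, 8 ≤ L' ∧ (L' : ℝ) ≤ T' * ℓ ∧ MarginConfinedAt r.ρ β L' ηc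

/-- **(CU) `PinnedConfinedCofinal η`** — row 42's floor-handshake node VERBATIM (`deconfinement_ruler.lean` §2; PROVED NECESSARY for PXcof(`η∕2`) there):
under the floor, cofinally in `β`, one `η`-margin-confined thick box `L ≥ 8` with `a(β)·L ≤ T`.  DERIVED here from (J) ∧ (LS) (`pinnedConfinedCofinal_of`). -/
def PinnedConfinedCofinal (η : ℝ) : Prop :=
  ∀ (G : Type) [Group G] [TopologicalSpace G] [IsTopologicalGroup G] [CompactSpace G],
    IsCompactSimpleLieGroup G → SimplyConnectedSpace G →
    letI : MeasurableSpace G := borel G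
    haveI : BorelSpace G := ⟨rfl⟩
    ∀ (r : LatticeRep G) (a : ℝ → ℝ), (∀ β, 0 < a β) → Tendsto a atTop (𝓝 0) → LowerBounds G r a →
      ∃ T : ℝ, ∀ β₁ : ℝ, ∃ β : ℝ, β₁ ≤ β ∧ ∃ L : ℕ, 8 ≤ L ∧ a β * (L : ℝ) ≤ T ∧ MarginConfinedAt r.ρ β L η

/-- **(G) `ConfinedToPure η θ`** — row 42's located residual VERBATIM (`deconfinement_ruler.lean` §2): `η`-margin-confined at `L` ⇒ `θ`-pure at `κL`,
`κ, β₀` uniform in the coupling (the gap in deconfinement units; floor-free, unit-free). -/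
def ConfinedToPure (η θ : ℝ) : Prop :=
  ∀ (G : Type) [Group G] [TopologicalSpace G] [IsTopologicalGroup G] [CompactSpace G],
    IsCompactSimpleLieGroup G → SimplyConnectedSpace G → (∃ z : G, z ∈ Subgroup.center G ∧ z ≠ 1) →
    letI : MeasurableSpace G := borel G
    haveI : BorelSpace G := ⟨rfl⟩
    ∀ r : LatticeRep G, ∃ κ : ℕ, ∃ β₀ : ℝ, 1 ≤ κ ∧ ∀ β : ℝ, β₀ ≤ β → ∀ L : ℕ, 8 ≤ L →
      MarginConfinedAt r.ρ β L η → coldDefect r.ρ β (κ * L) ≤ θ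

theorem landmarkSpacing_mono {ηc ηc' : ℝ} (hη : ηc ≤ ηc') (h : LandmarkSpacing ηc) : LandmarkSpacing ηc' := by
  intro G _ _ _ _ hG hsc hz
  letI : MeasurableSpace G := borel G
  haveI : BorelSpace G := ⟨rfl⟩
  intro r η hη0 hη1
  obtain ⟨T', hT'⟩ := h G hG hsc hz r η hη0 hη1
  refine ⟨T', fun β₁ => ?_⟩
  obtain ⟨β, hβ, hall⟩ := hT' β₁
  refine ⟨β, hβ, fun ℓ hth => ?_⟩
  obtain ⟨L', hL', hT, hconf⟩ := hall ℓ hth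
  exact ⟨L', hL', hT, marginConfinedAt_mono hη hconf⟩

/-! ## §2 Stubs (sorries ONLY here): (J), (LS), (G), (CF), N_cof -/

/-- **stub (J)** — LINE 1's junction (`running_landmark.lean`: `stub_pin : RunningWindow → HyperscalingEnvelope → PinnedThaw`, plan in its card §J). -/
theorem stub_pinnedThaw : PinnedThaw := by
  sorry

/-- **stub (LS)** — prompt confinement in landmark units, margin `1∕12`, cofinally (THE new statement of this line; infrared content, declared). -/
theorem stub_landmarkSpacing : LandmarkSpacing (1 / 12) := by
  sorry

/-- **stub (G)** — row 42's located residual verbatim: `1∕12`-margin-confined at `L` ⇒ `1∕24`-pure at `κL`. -/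
theorem stub_confinedToPure : ConfinedToPure (1 / 12) (1 / 24) := by
  sorry

/-- **stub (CF)** — PXcof(1∕24) on the centre-free class (declared residual). -/
theorem stub_pxcofCentreFree : PinnedExitsCofinalCentreFreeAt (1 / 24) := by
  sorry

/-- **stub N_cof** — the NECESSARY `π₁(G) ≠ 1` conjunct of the leaf BY NAME (`RankPurity.IRnscCof`). -/
theorem stub_irnscCof : IRnscCof := by
  sorry

/-! ## §3 Compositions (PROVED, stub-free) -/

/-- **THE SEAM: (J) ∧ (LS)(η_c) ⇒ (CU)(η_c)** for `η_c ≥ 0`.  With a nontrivial central twist: (J) gives `η, R, β₀` and, at every `β ≥ β₀`, an `η`-thawed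
`ℓ` with `a(β)·ℓ ≤ R`; (LS) at that `η` gives `T'` and cofinally a `β ≥ max β₁ β₀` at which every `η`-thawed half-side — in particular that `ℓ` — has an
`η_c`-confined `L' ≤ T'·ℓ`; so `a(β)·L' ≤ max T' 0 · R`.  Centre-free: every box is `η_c`-confined (`marginConfinedAt_of_centre_trivial`); pin `L = 8` at a
coupling with `a(β) ≤ 1` (`a → 0`). -/
theorem pinnedConfinedCofinal_of {ηc : ℝ} (hηc : 0 ≤ ηc) (hJ : PinnedThaw) (hLS : LandmarkSpacing ηc) : PinnedConfinedCofinal ηc := by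
  intro G _ _ _ _ hG hsc
  letI : MeasurableSpace G := borel G
  haveI : BorelSpace G := ⟨rfl⟩
  intro r a ha ha0 hlb
  by_cases hz : ∃ z : Fin 4 → G, IsCentralTwist z
  · obtain ⟨η, R, β₀, hη0, hη1, hpin⟩ := hJ G hG hsc hz r a ha ha0 hlb
    obtain ⟨T', hT'⟩ := hLS G hG hsc hz r η hη0 hη1
    refine ⟨max T' 0 * R, fun β₁ => ?_⟩
    obtain ⟨β, hβ, hall⟩ := hT' (max β₁ β₀)
    obtain ⟨ℓ, hth, hℓR⟩ := hpin β ((le_max_right _ _).trans hβ)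
    obtain ⟨L', hL'8, hL'T, hconf⟩ := hall ℓ hth
    refine ⟨β, (le_max_left _ _).trans hβ, L', hL'8, ?_, hconf⟩
    have hℓ0 : (0 : ℝ) ≤ (ℓ : ℝ) := Nat.cast_nonneg ℓ
    have haℓ : 0 ≤ a β * (ℓ : ℝ) := mul_nonneg (ha β).le hℓ0
    have hR0 : 0 ≤ R := haℓ.trans hℓR
    calc a β * (L' : ℝ) ≤ a β * (max T' 0 * ℓ) := by
            refine mul_le_mul_of_nonneg_left (hL'T.trans ?_) (ha β).le
            exact mul_le_mul_of_nonneg_right (le_max_left _ _) hℓ0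
      _ = max T' 0 * (a β * ℓ) := by ring
      _ ≤ max T' 0 * R := mul_le_mul_of_nonneg_left hℓR (le_max_right _ _)
  · haveI : SecondCountableTopology G :=
      (r.continuous.isClosedEmbedding r.injective).isEmbedding.secondCountableTopology
    have htriv := centre_trivial_of_no_twist hz
    have hev : ∀ᶠ β in atTop, a β < 1 := ha0.eventually (gt_mem_nhds one_pos)
    obtain ⟨β₂, hβ₂⟩ := hev.exists_forall_of_atTop
    refine ⟨8, fun β₁ => ⟨max β₁ β₂, le_max_left _ _, 8, le_rfl, ?_, ?_⟩⟩
    · have h1 : a (max β₁ β₂) < 1 := hβ₂ _ (le_max_right _ _)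
      have : a (max β₁ β₂) * ((8 : ℕ) : ℝ) ≤ 1 * ((8 : ℕ) : ℝ) :=
        mul_le_mul_of_nonneg_right h1.le (by positivity)
      simpa using this
    · exact marginConfinedAt_of_centre_trivial r.continuous htriv _ _ hηc

/-- **Row 42's composition, re-proved verbatim: (CU)(η) ∧ (G)(η,θ) ∧ (CF)(θ) ⇒ PXcof(θ).** -/
theorem pxcof_of_ruler {η θ : ℝ} (hCU : PinnedConfinedCofinal η) (hG : ConfinedToPure η θ)
    (hCF : PinnedExitsCofinalCentreFreeAt θ) : PinnedExitsCofinalAt θ := by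
  intro G _ _ _ _ hGs hsc
  letI : MeasurableSpace G := borel G
  haveI : BorelSpace G := ⟨rfl⟩
  intro r a ha ha0 hlb
  by_cases hZ : ∃ z : G, z ∈ Subgroup.center G ∧ z ≠ 1
  · obtain ⟨T, hcof⟩ := hCU G hGs hsc r a ha ha0 hlb
    obtain ⟨κ, β₀, hκ, hup⟩ := hG G hGs hsc hZ r
    refine ⟨(κ : ℝ) * T, fun β₁ => ?_⟩
    obtain ⟨β, hβ, L, hL, hpin, hconf⟩ := hcof (max β₁ β₀)
    refine ⟨β, (le_max_left _ _).trans hβ, κ * L, ?_, ?_, hup β ((le_max_right _ _).trans hβ) L hL hconf⟩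
    · calc 8 ≤ L := hL
        _ = 1 * L := (one_mul L).symm
        _ ≤ κ * L := Nat.mul_le_mul_right L hκ
    · have hk : (0 : ℝ) ≤ (κ : ℝ) := Nat.cast_nonneg κ
      calc a β * ((κ * L : ℕ) : ℝ) = (κ : ℝ) * (a β * (L : ℝ)) := by push_cast; ring
        _ ≤ (κ : ℝ) * T := mul_le_mul_of_nonneg_left hpin hk
  · push Not at hZ
    exact hCF G hGs hsc hZ r a ha ha0 hlb

/-- **PXcof(θ) ⇐ (J) ∧ (LS)(η_c) ∧ (G)(η_c, θ) ∧ (CF)(θ)** — the ladder. -/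
theorem pxcof_of {ηc θ : ℝ} (hηc : 0 ≤ ηc) (hJ : PinnedThaw) (hLS : LandmarkSpacing ηc) (hG : ConfinedToPure ηc θ)
    (hCF : PinnedExitsCofinalCentreFreeAt θ) : PinnedExitsCofinalAt θ :=
  pxcof_of_ruler (pinnedConfinedCofinal_of hηc hJ hLS) hG hCF

/-- The bill as ONE proposition (behind a `def`, so that `IRcof_of_stubs` is the file's only crux-headed theorem). -/
def Bill : Prop :=
  PinnedThaw → LandmarkSpacing (1 / 12) → ConfinedToPure (1 / 12) (1 / 24) → PinnedExitsCofinalCentreFreeAt (1 / 24) → IRnscCof →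
    Summit.QuantumFields.YangMills.Theses.BalabanLadder.IRcof

/-- **The bill holds** (PROVED composition): s.c. `G` — `pxcof_of` then the landed X-free cofinal kernel `cofinalGapOn_of_pinnedExits` (p616292);
`π₁(G) ≠ 1` — N_cof verbatim. -/
theorem IRcof_of : Bill := by
  intro hJ hLS hGc hCF hN G _ _ _ _ hG
  letI : MeasurableSpace G := borel G
  haveI : BorelSpace G := ⟨rfl⟩
  intro r a ha ha0 hlb
  by_cases hsc : SimplyConnectedSpace G
  · obtain ⟨T, hcof⟩ := pxcof_of (by norm_num) hJ hLS hGc hCF G hG hsc r a ha ha0 hlb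
    exact cofinalGapOn_of_pinnedExits r a ha ha0 hcof
  · exact hN G hG hsc r a ha ha0 hlb

/-- **`IRcof` (the route's decl, literally) from the registered stubs.** -/
theorem IRcof_of_stubs : Summit.QuantumFields.YangMills.Theses.BalabanLadder.IRcof :=
  IRcof_of stub_pinnedThaw stub_landmarkSpacing stub_confinedToPure stub_pxcofCentreFree stub_irnscCof

/-- The PXcof token alone, from the line's stubs (for the census: what this line prices PXcof(1∕24) at). -/
theorem pxcof24_of_stubs : PinnedExitsCofinalAt (1 / 24) :=
  pxcof_of (by norm_num) stub_pinnedThaw stub_landmarkSpacing stub_confinedToPure stub_pxcofCentreFree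

/-- Row 42's (CU)(1∕12) — PROVED necessary for PXcof(1∕24) there — from THIS line's (J) ∧ (LS) (what the seam discharges). -/
theorem cu12_of_stubs : PinnedConfinedCofinal (1 / 12) :=
  pinnedConfinedCofinal_of (by norm_num) stub_pinnedThaw stub_landmarkSpacing

/-! ## §4 PROVED RUNG: the (LS)-body inside the Dobrushin door, one group-free `T'` (format-grade; strong coupling, not the cofinal regime) -/

/-- **(LS) at strong coupling, every coupling in the door, `T' = L₀` group-free:** there is `L₀` such that for every compact metrisable `G`, every `r`,
every `0 ≤ β ≤ 1∕(216N)`, every margin `η` and every `η`-thawed half-side `ℓ`, the thick box `L' = L₀·ℓ` is `1∕12`-margin-confined — from the landed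
cold-purity corner `ColdPurityDobrushin.coldExitAt_corner_of_dobrushinTV` (every long box is `1∕24`-pure inside the door) and S1 for all twists. -/
theorem landmarkSpacing_rung_dobrushin :
    ∃ L₀ : ℕ, 1 ≤ L₀ ∧ ∀ (G : Type) [Group G] [TopologicalSpace G] [IsTopologicalGroup G] [CompactSpace G]
      [MeasurableSpace G] [BorelSpace G] (r : LatticeRep G) (β : ℝ), 0 ≤ β → 216 * (r.N : ℝ) * β ≤ 1 →
      ∀ (η : ℝ) (ℓ : ℕ), ThawedAt r.ρ β η ℓ →
        ∃ L' : ℕ, 8 ≤ L' ∧ (L' : ℝ) ≤ L₀ * ℓ ∧ MarginConfinedAt r.ρ β L' (1 / 12) := by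
  obtain ⟨L₀, hL₀⟩ := coldExitAt_corner_of_dobrushinTV (θ := 1 / 24) (by norm_num)
  refine ⟨max L₀ 1, le_max_right _ _, fun G _ _ _ _ _ _ r β h0 hβ η ℓ hth => ?_⟩
  haveI : SecondCountableTopology G :=
    (r.continuous.isClosedEmbedding r.injective).isEmbedding.secondCountableTopology
  have hℓ8 : 8 ≤ ℓ := hth.1
  refine ⟨max L₀ 1 * ℓ, ?_, ?_, ?_⟩
  · calc 8 ≤ ℓ := hℓ8
      _ = 1 * ℓ := (one_mul ℓ).symm
      _ ≤ max L₀ 1 * ℓ := Nat.mul_le_mul_right ℓ (le_max_right _ _)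
  · push_cast; exact le_rfl
  · have hpure : coldDefect r.ρ β (max L₀ 1 * ℓ) ≤ 1 / 24 := by
      refine hL₀ G r β h0 hβ _ ?_
      calc L₀ ≤ max L₀ 1 := le_max_left _ _
        _ = max L₀ 1 * 1 := (mul_one _).symm
        _ ≤ max L₀ 1 * ℓ := Nat.mul_le_mul_left _ (by omega)
    have hL8 : 8 ≤ max L₀ 1 * ℓ :=
      hℓ8.trans (by simpa using Nat.mul_le_mul_right ℓ (le_max_right L₀ 1))
    have h := marginConfinedAt_of_pure r.continuous r.mem_unitary h0 hL8 hpure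
    norm_num at h
    exact h

/-! ## §5 (rev 2, critic P2 of VERDICT-landmark-ladder-idea24-crit3-g4) THE SPLIT «LS = LS_UV ∧ LS_IR» UNDER THE FLOOR

The critic's reading: a prover of (LS) must own a UV half («no `η`-thaw of any central twist below `c(η)·Λ⁻¹`» = femto frozenness of the twisted coupling,
R4 ∕ (RW)-class) and an IR half (prompt confinement).  Typed here in the floor's unit `a` (the only unit the ladder ever consumes): the IR half is row 42's
(CU) `PinnedConfinedCofinal ηc` VERBATIM, the UV half is the new token (FF) `FemtoFreeze`, and (LS) asked only under the floor is `LandmarkSpacingFloor`.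
PROVED: `landmarkSpacingFloor_of_split : FemtoFreeze → PinnedConfinedCofinal ηc → LandmarkSpacingFloor ηc` (`T' = T∕c`), the intrinsic statement implies the
floor one (`landmarkSpacingFloor_of`), and the seam runs verbatim from the floor version (`pinnedConfinedCofinal_of_floor`), so under the floor and modulo the two
UV-class tokens (J), (FF):  (LS)_a ⟺ (CU).  Booking: (FF) against R4-class work (femto AF of the twisted coupling); (CU) = row 42; (LS) intrinsic = the
floor-free form.  HONEST: bookkeeping; nothing here proves (LS), (CU), (FF) or anything about Clay ∕ IRcof. -/

/-- **(FF) `FemtoFreeze` — the UV half of (LS) in the floor's unit.**  Under the floor, for every `η ∈ (0,1)` there are `c > 0` and `β₀` such that at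
every `β ≥ β₀` NO cold `4:1` box of half-side `ℓ < c∕a(β)` is `η`-thawed: the twisted (electric) coupling of boxes that are small in floor units stays
frozen.  Asymptotic freedom of the twisted finite-volume coupling read against the floor's unit (R4 ∕ row 48 (RW)-class; the floor makes `1∕a ≲ Λ⁻¹`-type
units comparable, cf. `AfOnset.unit_pow_eight_le_of_lowerBounds`).  Why it might fail: a lattice-artefact thaw at bounded `ℓ` (excluded physically by the
femto expansion around isolated twist-eaters: `r_k ≈ C·ḡ(ℓ)^p → 0` at fixed `ℓ` as `β → ∞`). -/
def FemtoFreeze : Prop :=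
  ∀ (G : Type) [Group G] [TopologicalSpace G] [IsTopologicalGroup G] [CompactSpace G],
    IsCompactSimpleLieGroup G → SimplyConnectedSpace G → (∃ z : Fin 4 → G, IsCentralTwist z) →
    letI : MeasurableSpace G := borel G
    haveI : BorelSpace G := ⟨rfl⟩
    ∀ (r : LatticeRep G) (a : ℝ → ℝ), (∀ β, 0 < a β) → Tendsto a atTop (𝓝 0) → LowerBounds G r a →
      ∀ η : ℝ, 0 < η → η < 1 → ∃ c β₀ : ℝ, 0 < c ∧ ∀ β : ℝ, β₀ ≤ β →
        ∀ ℓ : ℕ, ThawedAt r.ρ β η ℓ → c ≤ a β * (ℓ : ℝ)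

/-- **(LS)_a `LandmarkSpacingFloor ηc` — (LS) asked only of floor-carrying `(r, a)`** (the form the seam consumes; the floor hypotheses are threaded,
never used to change the conclusion). -/
def LandmarkSpacingFloor (ηc : ℝ) : Prop :=
  ∀ (G : Type) [Group G] [TopologicalSpace G] [IsTopologicalGroup G] [CompactSpace G],
    IsCompactSimpleLieGroup G → SimplyConnectedSpace G → (∃ z : Fin 4 → G, IsCentralTwist z) →
    letI : MeasurableSpace G := borel G
    haveI : BorelSpace G := ⟨rfl⟩
    ∀ (r : LatticeRep G) (a : ℝ → ℝ), (∀ β, 0 < a β) → Tendsto a atTop (𝓝 0) → LowerBounds G r a →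
      ∀ η : ℝ, 0 < η → η < 1 → ∃ T' : ℝ, ∀ β₁ : ℝ, ∃ β : ℝ, β₁ ≤ β ∧
        ∀ ℓ : ℕ, ThawedAt r.ρ β η ℓ → ∃ L' : ℕ, 8 ≤ L' ∧ (L' : ℝ) ≤ T' * ℓ ∧ MarginConfinedAt r.ρ β L' ηc

/-- The intrinsic (LS) implies the floor form (drop the floor). -/
theorem landmarkSpacingFloor_of {ηc : ℝ} (h : LandmarkSpacing ηc) : LandmarkSpacingFloor ηc := by
  intro G _ _ _ _ hG hsc hz
  letI : MeasurableSpace G := borel G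
  haveI : BorelSpace G := ⟨rfl⟩
  intro r a _ _ _ η hη0 hη1
  exact h G hG hsc hz r η hη0 hη1

/-- **THE SPLIT (PROVED): (FF) ∧ (CU)(ηc) ⇒ (LS)_a(ηc)**, with `T' = T∕c`. -/
theorem landmarkSpacingFloor_of_split {ηc : ℝ} (hFF : FemtoFreeze) (hCU : PinnedConfinedCofinal ηc) :
    LandmarkSpacingFloor ηc := by
  intro G _ _ _ _ hG hsc hz
  letI : MeasurableSpace G := borel G
  haveI : BorelSpace G := ⟨rfl⟩
  intro r a ha ha0 hlb η hη0 hη1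
  obtain ⟨c, β₀, hc, hfreeze⟩ := hFF G hG hsc hz r a ha ha0 hlb η hη0 hη1
  obtain ⟨T, hT⟩ := hCU G hG hsc r a ha ha0 hlb
  refine ⟨T / c, fun β₁ => ?_⟩
  obtain ⟨β, hβ, L, hL8, hLT, hconf⟩ := hT (max β₁ β₀)
  refine ⟨β, (le_max_left _ _).trans hβ, fun ℓ hth => ⟨L, hL8, ?_, hconf⟩⟩
  have hcℓ : c ≤ a β * (ℓ : ℝ) := hfreeze β ((le_max_right _ _).trans hβ) ℓ hth
  have ha' : 0 < a β := ha β
  have hL0 : (0 : ℝ) ≤ (L : ℝ) := Nat.cast_nonneg L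
  have hT0 : 0 ≤ T := (mul_nonneg ha'.le hL0).trans hLT
  -- `L ≤ T / a` and `T / a ≤ (T / c) * ℓ` because `c ≤ a ℓ`.
  have h1 : (L : ℝ) ≤ T / a β := by
    rw [le_div_iff₀ ha']; linarith [mul_comm (a β) (L : ℝ)]
  have h2 : T / a β ≤ T / c * (ℓ : ℝ) := by
    rw [div_le_iff₀ ha']
    have : T / c * (ℓ : ℝ) * a β = T * (a β * ℓ) / c := by ring
    rw [this, le_div_iff₀ hc]
    exact mul_le_mul_of_nonneg_left hcℓ hT0
  exact h1.trans h2

/-- **The seam from the floor form (PROVED, verbatim re-run of `pinnedConfinedCofinal_of`): (J) ∧ (LS)_a(ηc) ⇒ (CU)(ηc)** for `ηc ≥ 0`. -/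
theorem pinnedConfinedCofinal_of_floor {ηc : ℝ} (hηc : 0 ≤ ηc) (hJ : PinnedThaw) (hLS : LandmarkSpacingFloor ηc) :
    PinnedConfinedCofinal ηc := by
  intro G _ _ _ _ hG hsc
  letI : MeasurableSpace G := borel G
  haveI : BorelSpace G := ⟨rfl⟩
  intro r a ha ha0 hlb
  by_cases hz : ∃ z : Fin 4 → G, IsCentralTwist z
  · obtain ⟨η, R, β₀, hη0, hη1, hpin⟩ := hJ G hG hsc hz r a ha ha0 hlb
    obtain ⟨T', hT'⟩ := hLS G hG hsc hz r a ha ha0 hlb η hη0 hη1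
    refine ⟨max T' 0 * R, fun β₁ => ?_⟩
    obtain ⟨β, hβ, hall⟩ := hT' (max β₁ β₀)
    obtain ⟨ℓ, hth, hℓR⟩ := hpin β ((le_max_right _ _).trans hβ)
    obtain ⟨L', hL'8, hL'T, hconf⟩ := hall ℓ hth
    refine ⟨β, (le_max_left _ _).trans hβ, L', hL'8, ?_, hconf⟩
    have hℓ0 : (0 : ℝ) ≤ (ℓ : ℝ) := Nat.cast_nonneg ℓ
    have haℓ : 0 ≤ a β * (ℓ : ℝ) := mul_nonneg (ha β).le hℓ0
    have hR0 : 0 ≤ R := haℓ.trans hℓR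
    calc a β * (L' : ℝ) ≤ a β * (max T' 0 * ℓ) := by
            refine mul_le_mul_of_nonneg_left (hL'T.trans ?_) (ha β).le
            exact mul_le_mul_of_nonneg_right (le_max_left _ _) hℓ0
      _ = max T' 0 * (a β * ℓ) := by ring
      _ ≤ max T' 0 * R := mul_le_mul_of_nonneg_left hℓR (le_max_right _ _)
  · haveI : SecondCountableTopology G :=
      (r.continuous.isClosedEmbedding r.injective).isEmbedding.secondCountableTopology
    have htriv := centre_trivial_of_no_twist hz
    have hev : ∀ᶠ β in atTop, a β < 1 := ha0.eventually (gt_mem_nhds one_pos)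
    obtain ⟨β₂, hβ₂⟩ := hev.exists_forall_of_atTop
    refine ⟨8, fun β₁ => ⟨max β₁ β₂, le_max_left _ _, 8, le_rfl, ?_, ?_⟩⟩
    · have h1 : a (max β₁ β₂) < 1 := hβ₂ _ (le_max_right _ _)
      have : a (max β₁ β₂) * ((8 : ℕ) : ℝ) ≤ 1 * ((8 : ℕ) : ℝ) :=
        mul_le_mul_of_nonneg_right h1.le (by positivity)
      simpa using this
    · exact marginConfinedAt_of_centre_trivial r.continuous htriv _ _ hηc

/-- **Under the floor, modulo the UV-class tokens (J) and (FF): (LS)_a ⟺ (CU)** (both directions PROVED above; packaged). -/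
theorem landmarkSpacingFloor_iff_cu {ηc : ℝ} (hηc : 0 ≤ ηc) (hJ : PinnedThaw) (hFF : FemtoFreeze) :
    LandmarkSpacingFloor ηc ↔ PinnedConfinedCofinal ηc :=
  ⟨pinnedConfinedCofinal_of_floor hηc hJ, landmarkSpacingFloor_of_split hFF⟩

/-- PXcof through the floor form of (LS) (so a prover may discharge (LS)_a instead of the intrinsic (LS)). -/
theorem pxcof_of_floor {ηc θ : ℝ} (hηc : 0 ≤ ηc) (hJ : PinnedThaw) (hLS : LandmarkSpacingFloor ηc) (hG : ConfinedToPure ηc θ)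
    (hCF : PinnedExitsCofinalCentreFreeAt θ) : PinnedExitsCofinalAt θ :=
  pxcof_of_ruler (pinnedConfinedCofinal_of_floor hηc hJ hLS) hG hCF

end Summit.QuantumFields.YangMills.Cruxes.IRcof.LandmarkLadder
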